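import Literature.NumberTheory.Sieve.FriedlanderIwaniecPrimesPoisson2D
import HarnessLib

/-!
# Route `PrimeLevelFamEdge`, crux K_B (stmt-Parity-20343), line `diagonal_kernel_split` rev 4, plan Ω,
# a8P closable principal piece (input I1 of `OffDiagPrincipalClosableTotal`, part 2) — **generic sup and
# difference bounds for the one-variable Fourier transform of a function supported in an interval**

The principal samples of a8P are one-variable transforms `F(u) = 𝓕(t₁ ↦ Φ_{i,u}(t₁, y₂))(ξ)` of box weights
(`OffDiagBoxTransformRegularity.boxWeightU`, supported in `t₁ ∈ [K₁/2, 2K₁]`, `‖Φ_{i,u}‖ ≤ S₀` uniformly in `u`,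
`‖Φ_{i,u} − Φ_{i,u′}‖ ≤ L·|u − u′|`). C1 (`MellinBumpPhase`) needs `sup |F|` and a Lipschitz constant of `F` in `u`.
This file is the generic transport through the transform (`‖e(−vξ)‖ = 1`):

* **`norm_fourier_le_of_norm_le_of_support`** — `‖f‖ ≤ S` everywhere and `f = 0` off `[a, b]` ⇒
  `‖𝓕 f ξ‖ ≤ S·(b − a)` for every `ξ` (no measurability or integrability hypothesis);
* `integrable_ker_mul` — `v ↦ e(−vξ)·f(v)` is integrable for `f` continuous of compact support;
* `fourier_sub_eq` — `𝓕 f ξ − 𝓕 g ξ = 𝓕 (f − g) ξ` for `f, g` continuous of compact support;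
* **`norm_fourier_sub_le_of_norm_sub_le`** — `f, g` continuous, both `0` off `[a, b]`, `‖f − g‖ ≤ D` everywhere ⇒
  `‖𝓕 f ξ − 𝓕 g ξ‖ ≤ D·(b − a)`.

With `OffDiagBoxTransformRegularity` (`norm_boxWeightU_le`, `norm_boxWeightU_sub_le`, `boxWeightU_eq_zero_of_not_mem`,
`contDiff_uncurry_boxWeightU`): `‖F u‖ ≤ S₀·(3K₁/2)` and `‖F u − F u′‖ ≤ (2πS₁/(qc√u₀))·|u−u′|·(3K₁/2)` for
`u, u′ ≥ u₀ > 0`. Generic analysis; theorems only; standard axioms. Helper toward `stub_offDiagBelowSlack_io`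
(`--supports stmt-Parity-20343`); closes nothing.
«The programme SEARCHES and TYPES; no claim about Landau–Siegel zeros, Theorems 1–2 of arXiv:2211.02515 or
a repaired Margin232 until a kernel theorem says so.»
-/

noncomputable section

open Set MeasureTheory
open scoped Real FourierTransform

namespace Summit.Parity.GeneralizedHardyLittlewood.Theorems.BeyondDiagonalBeatsQuarter.OffDiag

open Literature.NumberTheory.Sieve.FriedlanderIwaniecPrimes (ker norm_ker continuous_ker fourier_eq_integral_ker)

/-- **Sup bound through the transform.** If `‖f t‖ ≤ S` for all `t` and `f t = 0` for `t ∉ [a, b]` (`a ≤ b`), then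
`‖𝓕 f ξ‖ ≤ S·(b − a)` for every `ξ` (`‖e(−vξ)‖ = 1`, the integral lives on `[a, b]`). [folklore] -/
theorem norm_fourier_le_of_norm_le_of_support {f : ℝ → ℂ} {a b S : ℝ} (hab : a ≤ b)
    (hf : ∀ t, ‖f t‖ ≤ S) (hsupp : ∀ t, t ∉ Icc a b → f t = 0) (ξ : ℝ) :
    ‖𝓕 f ξ‖ ≤ S * (b - a) := by
  rw [fourier_eq_integral_ker]
  have hzero : ∀ v, v ∉ Icc a b → ker v ξ * f v = 0 := fun v hv ↦ by rw [hsupp v hv, mul_zero]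
  rw [← setIntegral_eq_integral_of_forall_compl_eq_zero hzero]
  have hpt : ∀ v ∈ Icc a b, ‖ker v ξ * f v‖ ≤ S := fun v _ ↦ by
    rw [norm_mul, norm_ker, one_mul]; exact hf v
  refine (norm_setIntegral_le_of_norm_le_const measure_Icc_lt_top hpt).trans (le_of_eq ?_)
  rw [Real.volume_real_Icc_of_le hab]

/-- `v ↦ e(−vξ)·f(v)` is integrable for `f` continuous of compact support. [folklore] -/
theorem integrable_ker_mul {f : ℝ → ℂ} (hf : Continuous f) (hfs : HasCompactSupport f) (ξ : ℝ) :
    Integrable fun v : ℝ ↦ ker v ξ * f v := by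
  have hk : Continuous fun v : ℝ ↦ ker v ξ := continuous_ker.comp (continuous_id.prodMk continuous_const)
  exact (hk.mul hf).integrable_of_hasCompactSupport hfs.mul_left

/-- `𝓕 f ξ − 𝓕 g ξ = 𝓕 (f − g) ξ` for `f, g` continuous of compact support. [folklore] -/
theorem fourier_sub_eq {f g : ℝ → ℂ} (hf : Continuous f) (hfs : HasCompactSupport f) (hg : Continuous g)
    (hgs : HasCompactSupport g) (ξ : ℝ) : 𝓕 f ξ - 𝓕 g ξ = 𝓕 (f - g) ξ := by
  rw [fourier_eq_integral_ker, fourier_eq_integral_ker, fourier_eq_integral_ker,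
    ← integral_sub (integrable_ker_mul hf hfs ξ) (integrable_ker_mul hg hgs ξ)]
  refine integral_congr_ae (Filter.Eventually.of_forall fun v ↦ ?_)
  simp only [Pi.sub_apply]
  ring

/-- A function vanishing off `[a, b]` has compact support. [folklore] -/
theorem hasCompactSupport_of_support_Icc {f : ℝ → ℂ} {a b : ℝ} (hsupp : ∀ t, t ∉ Icc a b → f t = 0) :
    HasCompactSupport f := by
  refine HasCompactSupport.of_support_subset_isCompact (isCompact_Icc (a := a) (b := b)) fun t ht ↦ ?_
  by_contra hnot
  exact ht (hsupp t hnot)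

/-- **Difference bound through the transform.** For `f, g` continuous, both vanishing off `[a, b]` (`a ≤ b`), with
`‖f t − g t‖ ≤ D` for all `t`: `‖𝓕 f ξ − 𝓕 g ξ‖ ≤ D·(b − a)` for every `ξ`. [folklore] -/
theorem norm_fourier_sub_le_of_norm_sub_le {f g : ℝ → ℂ} {a b D : ℝ} (hab : a ≤ b)
    (hf : Continuous f) (hg : Continuous g) (hfs : ∀ t, t ∉ Icc a b → f t = 0)
    (hgs : ∀ t, t ∉ Icc a b → g t = 0) (hfg : ∀ t, ‖f t - g t‖ ≤ D) (ξ : ℝ) :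
    ‖𝓕 f ξ - 𝓕 g ξ‖ ≤ D * (b - a) := by
  rw [fourier_sub_eq hf (hasCompactSupport_of_support_Icc hfs) hg (hasCompactSupport_of_support_Icc hgs)]
  refine norm_fourier_le_of_norm_le_of_support hab (fun t ↦ ?_) (fun t ht ↦ ?_) ξ
  · simpa only [Pi.sub_apply] using hfg t
  · simp only [Pi.sub_apply, hfs t ht, hgs t ht, sub_zero]

/-- **A slice of a jointly continuous function is continuous**: `t₁ ↦ Φ(t₁, y₂)` for `uncurry Φ` continuous — the
form in which the box weights (`contDiff_uncurry_boxWeight(U)`) feed the two bounds above. [folklore] -/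
theorem continuous_slice_left {Φ : ℝ → ℝ → ℂ} (hΦ : Continuous (Function.uncurry Φ)) (y₂ : ℝ) :
    Continuous fun t₁ : ℝ ↦ Φ t₁ y₂ :=
  hΦ.comp (continuous_id.prodMk continuous_const)

end Summit.Parity.GeneralizedHardyLittlewood.Theorems.BeyondDiagonalBeatsQuarter.OffDiag
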